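import Mathlib
import HarnessLib
import Summits.MatrixMultiplication.MatrixMultiplication.Theorems.FarEdgeDescentAllArities
import Summits.MatrixMultiplication.MatrixMultiplication.Theorems.FarEdgeDescentCriterionDialB
import Summits.MatrixMultiplication.MatrixMultiplication.Theorems.FarEdgeDescentCert74P21
import Summits.MatrixMultiplication.MatrixMultiplication.Theorems.FarEdgeDescentSlab185190P37
import Summits.MatrixMultiplication.MatrixMultiplication.Theorems.FarEdgeDescentSlab190195P23
import Summits.MatrixMultiplication.MatrixMultiplication.Theorems.FarEdgeDescentSlab195197P17
import Summits.MatrixMultiplication.MatrixMultiplication.Theorems.FarEdgeDescentSlab197199P19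
import Summits.MatrixMultiplication.MatrixMultiplication.Theorems.FarEdgeDescentDialStaircase
import Summits.MatrixMultiplication.MatrixMultiplication.Theorems.FarEdgeDescentEndpointCriterion
import Summits.MatrixMultiplication.MatrixMultiplication.Theorems.FarEdgeDescentChordSplit
import Summits.MatrixMultiplication.MatrixMultiplication.Theorems.FarEdgeDescentCornerSymbolic

/-!
# Far-edge descent, kernel XLV — dial coverage: the structural trichotomy of the floor dial, as ONE statement

Lens «structural dichotomy (special vs generic)», MODEL level (kernel XL-D's floor-constrained
dial `(a, β)`: arity `a ≥ 2`, leg budget `β`).  Nothing here enters the route's cut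
`closes : FiniteSaturation → AnchoredLogConvexity → MatrixMultiplication`; rung currency 0.  This
file only ASSEMBLES landed theorems into the one statement critic g22 asked for (CRITIC-LEDGER
rows 556–574: «one theorem ∀ β ∈ [β₀,β₁] … not N files»), and states honestly what is NOT covered.

THE TRICHOTOMY of the dial `XL-D(a, β)` («for base deviations `y₀ b ≤ R/(b+β)` one constant bounds
`dev ≤ C·logSize^{κ_S}` over ALL admissible schedules», `κ_S = log₂(4/3)` = Schönhage's order):
* EMPTY regime `β < 2 − 1/a` (in particular `β < 3/2` for every `a ≥ 2`): NO schedule is admissible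
  (every schedule has a base leaf and a base passes the Strassen floor iff `β ≥ 2 − 1/a`,
  `admissible_base_iff` of XL-D) — `not_admissible_of_lt_floor`, so XL-D holds vacuously:
  `capXLD_of_lt_floor`.
* STRICT regime `2 − 1/a ≤ β < 2`: the cap holds with a positive but vanishing margin, paid by the
  narrowness floor `Vfloor` (XLIII: the floor is NECESSARY at every `β < 2`; XLIV: a depth-`m`
  certificate needs `β < 2 − a^{−(m+2)}`).  CERTIFIED (Lean, vertex certificates of depth 12, every
  arity `a ≥ 2`): the points `β = 8/5, 7/4` (`capXLD_allA_eight_fifths`, `capXLD_allA_7_4`) and the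
  interval `β ∈ [37/20, 199/100]` (`capXLD_allA_185_199`, four affine-floor slabs
  `[37/20,19/10] ∪ [19/10,39/20] ∪ [39/20,197/100] ∪ [197/100,199/100]`, 96 generated part files,
  each a list of exact rational vertex inequalities checked by `norm_num`).  SYMBOLIC (no
  certificate, every arity): the CORNER `β ∈ [199/100, 2)` that no fixed-depth certificate can reach
  (XLIV) — kernel XLVIII `FarEdgeDescentCornerSymbolic.capXLD_allA_corner`: the chord split of the
  region criterion (XLVII) reduces it to two polynomial conditions, proved for the β-dependent
  regulariser `ε = (2−β)²/32`, `z = 1/(1+ε)` and floor depth `m(β) → ∞` by a gain inequality per factor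
  and the product-floor exclusion for the pair.  Hence `capXLD_allA_185_2`: XL-D(a, β) for all `a ≥ 2`
  and ALL `β ∈ [37/20, 2]`.
* TIGHT endpoint `β = 2` (cost-free): the floor is `0` (XLIII `Vfloor_two_eq_zero`), the pair
  inequality at `κ_S` is an EQUALITY at the deep fixed point (XLIII `regionCriterion_two_tight`),
  no `κ < κ_S` is certifiable (XLIII `kappaS_le_of_regionCriterion_two`) — and XL-D(a, 2) HOLDS for
  every `a ≥ 2` by the symbolic endpoint theorem of kernel XLVI
  (`FarEdgeDescentEndpointCriterion.regionCriterion_two_floorZero`, indeed iff `κ_S ≤ κ`;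
  `capXLD_allA_two`); at the exact level the twice-squared Schönhage object realises the far edge
  `ω(1,1−x,a) ≤ 1+a` with coefficient EXACTLY one (kernel XXXVII) — capped AT, never below, Strassen's
  far-edge exponent.

NOT COVERED, said plainly: the window `[3/2, 37/20)` minus the two points `8/5, 7/4` — generic-regime
territory for the same certificate machine (≈ 100 more generated parts by the partial runs of memo
NODE-g63 §2.4; 54 further β certified numerically, NODE-g62 §2), deliberately not generated (economy
ruling, bus l.3154/l.3173); `capXLD_le_two_of_criterionFamily` records that a criterion family on that
window is all that separates the tree from XL-D(a, β) for every `a ≥ 2` and every `0 ≤ β ≤ 2`, and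
for arity `a ≥ 20/3` the window is already empty: `capXLD_le_two_of_large_arity` covers ALL of `[0, 2]`.  The
DEPTH LAW of the corner is recorded as a pair: `certificate_depth_law` (XLIV: a depth-`m` certificate
forces `β < 2 − 2^{−(m+2)}`) and `criterionFamily_corner` (XLVIII: on `[199/100, 2)` the family exists,
with depth `2^{−(m+2)} < (2−β)/64`).

HONEST FRAMING: assembly of landed model-level theorems plus the elementary empty-regime lemma;
no `sorry`, no new definitions, no axioms; nothing about tensors or `ω`.  References: kernels XL-D,
XLI, XLII (`FarEdgeDescentFloorDial`, `…NarrownessPotential`, `…FloorNarrowness`, `…SlabAffine`,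
`…AllArities`), the certificate chains Cert85/Cert74/Slab185190/Slab190195/Slab195197/Slab197199,
XLIII (`…DialDegeneration`), XLIV (`…DialStaircase`), XLVI (`…EndpointCriterion`), XLVII (`…ChordSplit`),
XLVIII (`…CornerLemmas`, `…CornerSymbolic`); Schönhage 1981 [Schonhage1981]; Strassen 1987
[Strassen1987]; Coppersmith–Winograd 1990 [CoppersmithWinograd1990].
-/

noncomputable section

set_option linter.dupNamespace false

namespace Summit.MatrixMultiplication.MatrixMultiplication.Theorems.FarEdgeDescentDialCoverage

open Finset
open Summit.MatrixMultiplication.MatrixMultiplication.Theorems.FarEdgeDescentFloorDial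
open Summit.MatrixMultiplication.MatrixMultiplication.Theorems.FarEdgeDescentFloorDial.Sched
open Summit.MatrixMultiplication.MatrixMultiplication.Theorems.FarEdgeDescentNarrownessPotential
open Summit.MatrixMultiplication.MatrixMultiplication.Theorems.FarEdgeDescentFloorNarrowness
open Summit.MatrixMultiplication.MatrixMultiplication.Theorems.FarEdgeDescentAllArities

/-! ## The EMPTY regime: below the Strassen floor nothing is admissible -/

/-- **Below the Strassen floor no schedule is admissible**: every schedule has a base leaf, and a
base passes the floors iff `β ≥ 2 − 1/a` (`admissible_base_iff`). -/
theorem not_admissible_of_lt_floor {a β : ℝ} (hβ : 0 ≤ β) (h : β < 2 - a⁻¹) :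
    ∀ s : Sched, ¬ Admissible a β s
  | base b, hs => by
      have := ((admissible_base_iff hβ b).mp hs).2
      linarith
  | node s _, hs => not_admissible_of_lt_floor hβ h s hs.1

/-- **XL-D in the empty regime** (vacuously): `β < 2 − 1/a`, `0 ≤ β`. -/
theorem capXLD_of_lt_floor {a β : ℝ} (hβ : 0 ≤ β) (h : β < 2 - a⁻¹) :
    ∀ R : ℝ, 0 ≤ R → ∀ y₀ : ℝ → ℝ, (∀ b : ℝ, 0 ≤ b → 0 ≤ y₀ b ∧ y₀ b ≤ R / (b + β)) →
      ∃ C : ℝ, ∀ s : Sched, Admissible a β s →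
        dev β y₀ s ≤ C * logSize β s ^ (Real.log (4 / 3) / Real.log 2) :=
  fun _ _ _ _ => ⟨0, fun s hs => absurd hs (not_admissible_of_lt_floor hβ h s)⟩

/-- For every arity `a ≥ 2` the empty regime contains `[0, 3/2)`. -/
theorem capXLD_of_lt_three_halves {a β : ℝ} (ha : 2 ≤ a) (hβ : 0 ≤ β) (h : β < 3 / 2) :
    ∀ R : ℝ, 0 ≤ R → ∀ y₀ : ℝ → ℝ, (∀ b : ℝ, 0 ≤ b → 0 ≤ y₀ b ∧ y₀ b ≤ R / (b + β)) →
      ∃ C : ℝ, ∀ s : Sched, Admissible a β s →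
        dev β y₀ s ≤ C * logSize β s ^ (Real.log (4 / 3) / Real.log 2) := by
  have ha0 : 0 < a := by linarith
  have : a⁻¹ ≤ 1 / 2 := by rw [inv_eq_one_div]; exact div_le_div_of_nonneg_left (by norm_num) (by norm_num) ha
  exact capXLD_of_lt_floor hβ (by linarith)

/-! ## The STRICT regime: the certified dials, every arity -/

/-- **XL-D(a, 7/4) for every `a ≥ 2`** (the Cert74 chain, concluded by `FarEdgeDescentCert74P21`). -/
theorem capXLD_allA_7_4 {a : ℝ} (ha : 2 ≤ a) :
    ∀ R : ℝ, 0 ≤ R → ∀ y₀ : ℝ → ℝ, (∀ b : ℝ, 0 ≤ b → 0 ≤ y₀ b ∧ y₀ b ≤ R / (b + 7 / 4)) →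
      ∃ C : ℝ, ∀ s : Sched, Admissible a (7 / 4) s →
        dev (7 / 4) y₀ s ≤ C * logSize (7 / 4) s ^ (Real.log (4 / 3) / Real.log 2) :=
  capXLD_allA_of_criterion 12 ha (by norm_num) (by norm_num) (by norm_num) (by norm_num) (by norm_num)
    (le_trans (by norm_num) FarEdgeDescentCriterionDialB.Vfloor_7_4) FarEdgeDescentCert74.regionCriterion_7_4

/-- **XL-D(a, β) for every `a ≥ 2` and EVERY `β ∈ [37/20, 199/100]`** — one statement, four
affine-floor slab certificates. -/
theorem capXLD_allA_185_199 :
    ∀ a β : ℝ, 2 ≤ a → 37 / 20 ≤ β → β ≤ 199 / 100 →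
      ∀ R : ℝ, 0 ≤ R → ∀ y₀ : ℝ → ℝ, (∀ b : ℝ, 0 ≤ b → 0 ≤ y₀ b ∧ y₀ b ≤ R / (b + β)) →
        ∃ C : ℝ, ∀ s : Sched, Admissible a β s →
          dev β y₀ s ≤ C * logSize β s ^ (Real.log (4 / 3) / Real.log 2) := by
  intro a β ha h0 h1
  by_cases h190 : β ≤ 19 / 10
  · exact capXLD_allA_of_slabA 12 (by norm_num) (by norm_num) (by norm_num) (by norm_num) (by norm_num)
      FarEdgeDescentSlab185190.floor_185_190 FarEdgeDescentSlab185190.regionCriterion_185_190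
      a β ha h0 h190
  by_cases h195 : β ≤ 39 / 20
  · exact capXLD_allA_of_slabA 12 (by norm_num) (by norm_num) (by norm_num) (by norm_num) (by norm_num)
      FarEdgeDescentSlab190195.floor_190_195 FarEdgeDescentSlab190195.regionCriterion_190_195
      a β ha (by linarith) h195
  by_cases h197 : β ≤ 197 / 100
  · exact capXLD_allA_of_slabA 12 (by norm_num) (by norm_num) (by norm_num) (by norm_num) (by norm_num)
      FarEdgeDescentSlab195197.floor_195_197 FarEdgeDescentSlab195197.regionCriterion_195_197
      a β ha (by linarith) h197
  · exact capXLD_allA_of_slabA 12 (by norm_num) (by norm_num) (by norm_num) (by norm_num) (by norm_num)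
      FarEdgeDescentSlab197199.floor_197_199 FarEdgeDescentSlab197199.regionCriterion_197_199
      a β ha (by linarith) h1

/-- **XL-D(a, β) for every `a ≥ 2` and EVERY `β ∈ [37/20, 2]`** — the four slab certificates on
`[37/20, 199/100]`, the symbolic corner theorem of kernel XLVIII on `[199/100, 2)`, and the symbolic
endpoint theorem of kernel XLVI at `β = 2`. -/
theorem capXLD_allA_185_2 :
    ∀ a β : ℝ, 2 ≤ a → 37 / 20 ≤ β → β ≤ 2 →
      ∀ R : ℝ, 0 ≤ R → ∀ y₀ : ℝ → ℝ, (∀ b : ℝ, 0 ≤ b → 0 ≤ y₀ b ∧ y₀ b ≤ R / (b + β)) →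
        ∃ C : ℝ, ∀ s : Sched, Admissible a β s →
          dev β y₀ s ≤ C * logSize β s ^ (Real.log (4 / 3) / Real.log 2) := by
  intro a β ha h0 h2
  by_cases h199 : β ≤ 199 / 100
  · exact capXLD_allA_185_199 a β ha h0 h199
  rcases h2.lt_or_eq with hlt | heq
  · exact FarEdgeDescentCornerSymbolic.capXLD_allA_corner a β ha (by linarith) hlt
  · subst heq; exact FarEdgeDescentEndpointCriterion.capXLD_allA_two ha

/-! ## The coverage statement -/

/-- **DIAL COVERAGE (model level).** For every arity `a ≥ 2` and every budget `β ≥ 0` that is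
below `3/2` (empty regime), equal to `8/5` or `7/4` (certified points), or in the closed interval
`[37/20, 2]` (certified slabs on `[37/20, 199/100]`, the symbolic corner `[199/100, 2)` of kernel XLVIII,
the symbolic endpoint `β = 2` of kernel XLVI), XL-D(a, β) holds: one constant caps
`dev ≤ C·logSize^{κ_S}` over all admissible schedules. -/
theorem dialCoverage {a β : ℝ} (ha : 2 ≤ a) (hβ : 0 ≤ β)
    (h : β < 3 / 2 ∨ β = 8 / 5 ∨ β = 7 / 4 ∨ (37 / 20 ≤ β ∧ β ≤ 2)) :
    ∀ R : ℝ, 0 ≤ R → ∀ y₀ : ℝ → ℝ, (∀ b : ℝ, 0 ≤ b → 0 ≤ y₀ b ∧ y₀ b ≤ R / (b + β)) →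
      ∃ C : ℝ, ∀ s : Sched, Admissible a β s →
        dev β y₀ s ≤ C * logSize β s ^ (Real.log (4 / 3) / Real.log 2) := by
  rcases h with h | h | h | ⟨h0, h1⟩
  · exact capXLD_of_lt_three_halves ha hβ h
  · subst h; exact capXLD_allA_eight_fifths ha
  · subst h; exact capXLD_allA_7_4 ha
  · exact capXLD_allA_185_2 a β ha h0 h1

/-- **Large arity: the whole dial `[0, 2]` is covered.**  For every arity `a ≥ 20/3` (so every
integer arity `a ≥ 7`) the empty regime `β < 2 − 1/a` already swallows the uncertified window
`[3/2, 37/20)`, hence XL-D(a, β) holds for EVERY `0 ≤ β ≤ 2` — empty regime below `2 − 1/a`,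
`capXLD_allA_185_2` on `[37/20, 2]`. -/
theorem capXLD_le_two_of_large_arity {a β : ℝ} (ha : 20 / 3 ≤ a) (hβ : 0 ≤ β) (h2 : β ≤ 2) :
    ∀ R : ℝ, 0 ≤ R → ∀ y₀ : ℝ → ℝ, (∀ b : ℝ, 0 ≤ b → 0 ≤ y₀ b ∧ y₀ b ≤ R / (b + β)) →
      ∃ C : ℝ, ∀ s : Sched, Admissible a β s →
        dev β y₀ s ≤ C * logSize β s ^ (Real.log (4 / 3) / Real.log 2) := by
  by_cases h : β < 37 / 20
  · have ha0 : (0 : ℝ) < a := by linarith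
    have hinv : a⁻¹ ≤ 3 / 20 := by
      rw [inv_le_comm₀ ha0 (by norm_num)]
      norm_num
      linarith
    exact capXLD_of_lt_floor hβ (by linarith)
  · exact capXLD_allA_185_2 a β (by linarith) (not_lt.mp h) h2

/-- The `a = 2` reading (the Coppersmith–Winograd arity): XL-D(2, β) for `β < 3/2`, `β ∈ {8/5, 7/4}`
and every `β ∈ [37/20, 2]`. -/
theorem dialCoverage_two {β : ℝ} (hβ : 0 ≤ β)
    (h : β < 3 / 2 ∨ β = 8 / 5 ∨ β = 7 / 4 ∨ (37 / 20 ≤ β ∧ β ≤ 2)) :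
    ∀ R : ℝ, 0 ≤ R → ∀ y₀ : ℝ → ℝ, (∀ b : ℝ, 0 ≤ b → 0 ≤ y₀ b ∧ y₀ b ≤ R / (b + β)) →
      ∃ C : ℝ, ∀ s : Sched, Admissible 2 β s →
        dev β y₀ s ≤ C * logSize β s ^ (Real.log (4 / 3) / Real.log 2) :=
  dialCoverage le_rfl hβ h

/-! ## What is left: the window `[3/2, 37/20)` -/

/-- **XL-D up to and including the cost-free budget, reduced to the uncertified window.**  A criterion
family on `[3/2, 37/20)` alone (for each such `β` some scale `z ∈ [9/10,1]`, slack `ε > 0` and depth `m`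
making the region criterion hold at `κ_S` with the exact floor; routine certificates, not generated)
gives XL-D(a, β) for every `a ≥ 2` and EVERY `0 ≤ β ≤ 2`: below `3/2` the regime is empty and
`[37/20, 2]` is `capXLD_allA_185_2`. -/
theorem capXLD_le_two_of_criterionFamily
    (h : ∀ β : ℝ, 3 / 2 ≤ β → β < 37 / 20 → ∃ z ε : ℝ, ∃ m : ℕ, 9 / 10 ≤ z ∧ z ≤ 1 ∧ 0 < ε ∧
      RegionCriterion β z ε (Vfloor 2 β z m) (Real.log (4 / 3) / Real.log 2)) :
    ∀ a β : ℝ, 2 ≤ a → 0 ≤ β → β ≤ 2 →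
      ∀ R : ℝ, 0 ≤ R → ∀ y₀ : ℝ → ℝ, (∀ b : ℝ, 0 ≤ b → 0 ≤ y₀ b ∧ y₀ b ≤ R / (b + β)) →
        ∃ C : ℝ, ∀ s : Sched, Admissible a β s →
          dev β y₀ s ≤ C * logSize β s ^ (Real.log (4 / 3) / Real.log 2) := by
  intro a β ha hβ h2
  by_cases hlt : β < 3 / 2
  · exact capXLD_of_lt_three_halves ha hβ hlt
  by_cases h185 : β < 37 / 20
  · obtain ⟨z, ε, m, hz, hz1, hε, hcrit⟩ := h β (not_lt.mp hlt) h185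
    exact capXLD_allA_of_criterion m ha (not_lt.mp hlt) (by linarith) hz hz1 hε le_rfl hcrit
  · exact capXLD_allA_185_2 a β ha (not_lt.mp h185) h2

/-! ## The depth law of the corner (XLIV necessity, XLVIII sufficiency) -/

/-- **Necessity (XLIV): a certificate of floor depth `m` lives strictly below the `m`-th stair.**  If the
region criterion holds at `κ_S` with a narrowness floor dominated by `Vfloor 2 β z m` (any `z`, any
`ε > −1`) at some `1 ≤ β < 2`, then `β < 2 − 2^{−(m+2)}`: the depth must grow like `log₂ (1/(2−β))`
towards the endpoint, and NO fixed depth serves the whole corner (the certified depth `m = 12` dies on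
`[2 − 2^{−14}, 2)`: XLIV `no_depth12_certificate_near_two`, cited not restated). -/
theorem certificate_depth_law {β z ε Vmin : ℝ} {m : ℕ} (hβ1 : 1 ≤ β) (hβ2 : β < 2) (hε : -1 < ε)
    (hV : Vmin ≤ Vfloor 2 β z m)
    (h : RegionCriterion β z ε Vmin (Real.log (4 / 3) / Real.log 2)) :
    β < 2 - (2 : ℝ)⁻¹ ^ (m + 2) :=
  FarEdgeDescentDialStaircase.lt_stair_of_regionCriterion (a := 2) (by norm_num) hβ1 hβ2 hε hV h

/-- **Sufficiency (XLVIII): the criterion family EXISTS on the whole corner.**  For every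
`β ∈ [199/100, 2)` some scale `z ∈ [9/10, 1]`, slack `ε > 0` and depth `m` make the region criterion
hold at `κ_S` with the exact floor `Vfloor 2 β z m` — the hypothesis of g63's earlier reduction,
now a theorem (chord split XLVII + corner scheme XLVIII: `ε = (2−β)²/32`, `z = 1/(1+ε)`,
`2^{−(m+2)} < (2−β)/64`, consistent with the necessity above). -/
theorem criterionFamily_corner :
    ∀ β : ℝ, 199 / 100 ≤ β → β < 2 → ∃ z ε : ℝ, ∃ m : ℕ, 9 / 10 ≤ z ∧ z ≤ 1 ∧ 0 < ε ∧
      RegionCriterion β z ε (Vfloor 2 β z m) (Real.log (4 / 3) / Real.log 2) := by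
  intro β h0 h1
  obtain ⟨z, ε, m, hz, hz1, hε, h⟩ := FarEdgeDescentCornerSymbolic.chordConditions_corner β h0 h1
  exact ⟨z, ε, m, hz, hz1, hε,
    FarEdgeDescentChordSplit.regionCriterion_of_chordConditions (by linarith) hε.le h⟩

end Summit.MatrixMultiplication.MatrixMultiplication.Theorems.FarEdgeDescentDialCoverage
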